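import Summits.QuantumFields.QCD.Theorems.QuarksAsStableActionCriticalLineDiamagnetismCheckerSound

/-!
# Block-margin certificate checker — symmetries, chamber reduction, regions (crux stmt-QuantumFields-9734, lead c3)

* Reflection invariance `blockHc (reflectC τ C) = blockHc C` (flip any set of signs of `C`; reindex the shift sum by
  `σ ↦ σ + τ`) and permutation equivariance `blockHc (permC π C) (permC π s) μ ν = blockHc C s (π μ) (π ν)`;
  transfer of `BlockMargin` under both; `margin_of_chamber`: a reflection- and permutation-invariant hypothesis
  implies all block margins as soon as it does so on the sorted nonnegative chamber (`|C|` sorted by `Tuple.sort`);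
  `margin_of_certify`: the box-cover form with the bisection driver.
* The regions: `nNear`/`InRegion` are invariant; crude rational bounds `0.8717 ≤ cos ½ ≤ 0.8783`,
  `cos (1/20) ≤ 0.99875033` (`Real.cos_bound`), whence `thresholds` for `K0`, `K0m`, `K2` at scale `SC = 2²⁰`, and
  `mem_roots`: every sorted nonnegative point of region `r ≤ 3` lies in a box of `roots r`.

Pure theorem file; no definitions, no facts, no axioms.
-/

namespace Summit.QuantumFields.QCD.Cruxes.CriticalLineDiamagnetism.ChessboardCellGain.Checker

open Finset
/-! ### Symmetries of the closed form: reflections `C_κ ↦ ±C_κ` and permutations of the axes -/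

section Symmetry

variable (C : Fin 4 → ℝ)

/-- `sgn` of a sum of classes is the product of the signs. -/
theorem sgn_add (t t' : Fin 4 → ZMod 2) (κ : Fin 4) : sgn (t + t') κ = sgn t κ * sgn t' κ := by
  unfold sgn
  rw [Pi.add_apply, ← pow_add]
  obtain ⟨n, hn⟩ : ∃ n : ℕ, (t κ).val + (t' κ).val = (t κ + t' κ).val + 2 * n := by
    have h := ZMod.val_add (t κ) (t' κ)
    refine ⟨((t κ).val + (t' κ).val) / 2, ?_⟩
    rw [h]; omega
  rw [hn, pow_add, pow_mul]; norm_num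

/-- `sgn t κ ∈ {±1}`, so its square is `1`. -/
theorem sgn_mul_self (t : Fin 4 → ZMod 2) (κ : Fin 4) : sgn t κ * sgn t κ = 1 := by
  unfold sgn; rw [← pow_add, ← two_mul, pow_mul]; norm_num

/-- `1 − C²` is invariant under sign flips. -/
theorem s2_reflect (τ : Fin 4 → ZMod 2) (κ : Fin 4) : s2 (reflectC τ C) κ = s2 C κ := by
  unfold s2 reflectC; rw [mul_pow, show sgn τ κ ^ 2 = 1 by rw [sq, sgn_mul_self], one_mul]

/-- The signed coordinate `σ_κ C_κ` is invariant under a simultaneous flip of `σ_κ` and `C_κ`. -/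
theorem sgnC_reflect (τ σ : Fin 4 → ZMod 2) (κ : Fin 4) :
    sgn (σ + τ) κ * reflectC τ C κ = sgn σ κ * C κ := by
  unfold reflectC; rw [sgn_add, mul_assoc, ← mul_assoc (sgn τ κ), sgn_mul_self, one_mul]

/-- `A(σ)` is invariant under sign flips with the shift relabelled. -/
theorem aW_reflect (τ σ : Fin 4 → ZMod 2) : aW (reflectC τ C) (σ + τ) = aW C σ := by
  unfold aW; simp only [sgnC_reflect]

/-- `h(σ)` is invariant under sign flips with the shift relabelled. -/
theorem hW_reflect (τ σ : Fin 4 → ZMod 2) : hW (reflectC τ C) (σ + τ) = hW C σ := by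
  unfold hW; simp only [aW_reflect, s2_reflect]

/-- `W(s)` is invariant under sign flips. -/
theorem wS_reflect (τ s : Fin 4 → ZMod 2) : wS (reflectC τ C) s = wS C s := by
  unfold wS; simp only [s2_reflect]

/-- `T` is invariant under sign flips with the shift relabelled. -/
theorem tB_reflect (τ σ s : Fin 4 → ZMod 2) (μ ν : Fin 4) :
    tB (reflectC τ C) (σ + τ) s μ ν = tB C σ s μ ν := by
  unfold tB
  rw [add_right_comm σ τ s]
  simp only [aW_reflect, s2_reflect, wS_reflect, sgnC_reflect]

/-- **Reflection invariance**: flipping the signs of any set of coordinates of `C` leaves every entry unchanged. -/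
theorem blockHc_reflect (τ s : Fin 4 → ZMod 2) (μ ν : Fin 4) :
    blockHc (reflectC τ C) s μ ν = blockHc C s μ ν := by
  unfold blockHc
  congr 1
  · split_ifs with h
    · refine (Fintype.sum_equiv (Equiv.addRight τ) _ _ fun σ => ?_).symm
      simp only [Equiv.coe_addRight, hW_reflect, aW_reflect, s2_reflect, sgnC_reflect]
    · rfl
  · refine (Fintype.sum_equiv (Equiv.addRight τ) _ _ fun σ => ?_).symm
    simp only [Equiv.coe_addRight]
    rw [tB_reflect, hW_reflect, show σ + τ + s = σ + s + τ from add_right_comm σ τ s, hW_reflect]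

/-- `A` is invariant under relabelling of the axes. -/
theorem aW_perm (π : Equiv.Perm (Fin 4)) (σ : Fin 4 → ZMod 2) : aW (permC π C) (permC π σ) = aW C σ := by
  unfold aW permC sgn
  exact Equiv.sum_comp π (fun κ => 1 - (-1 : ℝ) ^ (σ κ).val * C κ)

/-- `1 − C²` relabels with the axes. -/
theorem s2_perm (π : Equiv.Perm (Fin 4)) (κ : Fin 4) : s2 (permC π C) κ = s2 C (π κ) := rfl

/-- `h` is invariant under relabelling of the axes. -/
theorem hW_perm (π : Equiv.Perm (Fin 4)) (σ : Fin 4 → ZMod 2) : hW (permC π C) (permC π σ) = hW C σ := by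
  unfold hW; rw [aW_perm]; simp only [s2_perm]; rw [Equiv.sum_comp π (fun κ => s2 C κ)]

/-- `W` is invariant under relabelling of the axes. -/
theorem wS_perm (π : Equiv.Perm (Fin 4)) (s : Fin 4 → ZMod 2) : wS (permC π C) (permC π s) = wS C s := by
  unfold wS permC sgn s2
  exact Equiv.sum_comp π (fun κ => (-1 : ℝ) ^ (s κ).val * (1 - C κ ^ 2))

/-- Relabelling commutes with addition of classes. -/
theorem permC_add (π : Equiv.Perm (Fin 4)) (σ s : Fin 4 → ZMod 2) : permC π σ + permC π s = permC π (σ + s) := rfl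

/-- `T` relabels with the axes. -/
theorem tB_perm (π : Equiv.Perm (Fin 4)) (σ s : Fin 4 → ZMod 2) (μ ν : Fin 4) :
    tB (permC π C) (permC π σ) (permC π s) μ ν = tB C σ s (π μ) (π ν) := by
  unfold tB
  rw [permC_add, aW_perm, aW_perm, wS_perm]
  simp only [s2_perm, π.injective.eq_iff]
  rfl

/-- **Permutation equivariance**: relabelling the axes of `C` and `s` relabels the entries. -/
theorem blockHc_perm (π : Equiv.Perm (Fin 4)) (s : Fin 4 → ZMod 2) (μ ν : Fin 4) :
    blockHc (permC π C) (permC π s) μ ν = blockHc C s (π μ) (π ν) := by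
  unfold blockHc
  -- reindex the shift sums by `σ ↦ σ ∘ π`
  let e : (Fin 4 → ZMod 2) ≃ (Fin 4 → ZMod 2) := Equiv.arrowCongr π.symm (Equiv.refl _)
  have he : ∀ σ, e σ = permC π σ := fun σ => by
    funext κ; simp [e, Equiv.arrowCongr_apply, permC]
  congr 1
  · simp only [π.injective.eq_iff]
    split_ifs with h
    · rw [← e.sum_comp]
      refine Finset.sum_congr rfl fun σ _ => ?_
      rw [he, hW_perm, aW_perm, s2_perm]; rfl
    · rfl
  · rw [← e.sum_comp]
    refine Finset.sum_congr rfl fun σ _ => ?_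
    rw [he, tB_perm, hW_perm, permC_add, hW_perm]

/-- `nAct` is invariant under relabelling. -/
theorem nAct_perm (π : Equiv.Perm (Fin 4)) (s : Fin 4 → ZMod 2) : nAct (permC π s) = nAct s := by
  unfold nAct permC
  rw [show (Finset.univ.filter fun μ : Fin 4 => s (π μ) = 1) =
      (Finset.univ.filter fun ν : Fin 4 => s ν = 1).map π.symm.toEmbedding by
    ext μ; simp [Finset.mem_map_equiv], Finset.card_map]

end Symmetry

/-! ### Transfer of the block margin under the symmetries; reduction to the sorted nonnegative chamber -/

section Chamber

/-- Reflections do not change the block margin statement. -/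
theorem BlockMargin.of_reflect {γ : ℝ} {C : Fin 4 → ℝ} (τ : Fin 4 → ZMod 2) {s : Fin 4 → ZMod 2}
    (h : BlockMargin γ (reflectC τ C) s) : BlockMargin γ C s := by
  refine ⟨fun y hy0 hsum => ?_⟩
  have := h.le y hy0 hsum
  simpa only [blockHc_reflect] using this

/-- Relabelling the axes does not change the block margin statement. -/
theorem BlockMargin.of_perm {γ : ℝ} {C : Fin 4 → ℝ} (π : Equiv.Perm (Fin 4)) {s : Fin 4 → ZMod 2}
    (h : BlockMargin γ (permC π C) (permC π s)) : BlockMargin γ C s := by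
  refine ⟨fun y hy0 hsum => ?_⟩
  have h1 := h.le (permC π y) (fun μ hμ => hy0 (π μ) hμ)
    (by rw [← hsum]; exact Equiv.sum_comp π y)
  rw [nAct_perm] at h1
  have e1 : ∑ μ, permC π y μ ^ 2 = ∑ μ, y μ ^ 2 := Equiv.sum_comp π (fun μ => y μ ^ 2)
  have e2 : ∑ μ, ∑ ν, blockHc (permC π C) (permC π s) μ ν * (permC π y μ * permC π y ν) =
      ∑ μ, ∑ ν, blockHc C s μ ν * (y μ * y ν) := by
    simp only [blockHc_perm]
    rw [← Equiv.sum_comp π (fun μ => ∑ ν, blockHc C s μ ν * (y μ * y ν))]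
    refine Finset.sum_congr rfl fun μ _ => ?_
    exact Equiv.sum_comp π (fun ν => blockHc C s (π μ) ν * (y (π μ) * y ν))
  rw [e1, e2] at h1
  exact h1

/-- Flipping by `absPattern` produces `|C|`. -/
theorem reflectC_absPattern (C : Fin 4 → ℝ) (κ : Fin 4) : reflectC (absPattern C) C κ = |C κ| := by
  show (-1 : ℝ) ^ ((if C κ < 0 then (1 : ZMod 2) else 0)).val * C κ = |C κ|
  by_cases h : C κ < 0
  · rw [if_pos h, abs_of_neg h, ZMod.val_one]; ring
  · rw [if_neg h, abs_of_nonneg (not_lt.1 h), ZMod.val_zero]; ring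

/-- **Reduction to the chamber**: a reflection- and permutation-invariant hypothesis `R` implies the block margins
for all classes as soon as it does so at the sorted nonnegative representatives. -/
theorem margin_of_chamber (γ : ℝ) (R : (Fin 4 → ℝ) → Prop)
    (hRrefl : ∀ C τ, R C → R (reflectC τ C)) (hRperm : ∀ C (π : Equiv.Perm (Fin 4)), R C → R (permC π C))
    (h : ∀ C, R C → (∀ κ, 0 ≤ C κ) → C 0 ≤ C 1 → C 1 ≤ C 2 → C 2 ≤ C 3 → ∀ s, BlockMargin γ C s) :
    ∀ C, R C → ∀ s, BlockMargin γ C s := by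
  intro C hC s
  -- reflect to the nonnegative orthant
  set C₁ := reflectC (absPattern C) C with hC₁
  have hpos : ∀ κ, 0 ≤ C₁ κ := fun κ => by rw [hC₁, reflectC_absPattern]; exact abs_nonneg _
  have hR₁ : R C₁ := hRrefl C _ hC
  refine BlockMargin.of_reflect (absPattern C) ?_
  rw [← hC₁]
  -- sort
  let π : Equiv.Perm (Fin 4) := Tuple.sort C₁
  have hmono : Monotone (permC π C₁) := Tuple.monotone_sort C₁
  have hR₂ : R (permC π C₁) := hRperm C₁ π hR₁
  have hall := h (permC π C₁) hR₂ (fun κ => hpos (π κ))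
    (hmono (by decide : (0 : Fin 4) ≤ 1)) (hmono (by decide : (1 : Fin 4) ≤ 2)) (hmono (by decide : (2 : Fin 4) ≤ 3))
  exact BlockMargin.of_perm π (hall (permC π s))

/-- **Box-cover form**: if every root box is certified by the bisection driver with a sound leaf test, and every sorted
nonnegative point satisfying `R` lies in some root box, then `R` implies all block margins. -/
theorem margin_of_certify (S : ℕ) (γ : ℝ) (leafOK : IBox → Bool)
    (hleaf : ∀ B, leafOK B = true → ∀ C, IBox.mem S B C → ∀ s, BlockMargin γ C s)
    (fuel : ℕ) (roots : List IBox) (hcert : ∀ B ∈ roots, certify leafOK fuel B = true)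
    (R : (Fin 4 → ℝ) → Prop)
    (hRrefl : ∀ C τ, R C → R (reflectC τ C)) (hRperm : ∀ C (π : Equiv.Perm (Fin 4)), R C → R (permC π C))
    (hroot : ∀ C, R C → (∀ κ, 0 ≤ C κ) → C 0 ≤ C 1 → C 1 ≤ C 2 → C 2 ≤ C 3 → ∃ B ∈ roots, IBox.mem S B C) :
    ∀ C, R C → ∀ s, BlockMargin γ C s := by
  refine margin_of_chamber γ R hRrefl hRperm fun C hC hpos h01 h12 h23 => ?_
  obtain ⟨B, hB, hmem⟩ := hroot C hC hpos h01 h12 h23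
  exact certify_sound S (fun C => ∀ s, BlockMargin γ C s) leafOK hleaf fuel B (hcert B hB) C hmem h01 h12 h23

end Chamber

/-! ### The regions in the `C`-coordinates -/

section Regions

/-- `nNear` is invariant under sign flips. -/
theorem nNear_reflect (C : Fin 4 → ℝ) (τ : Fin 4 → ZMod 2) : nNear (reflectC τ C) = nNear C := by
  unfold nNear reflectC
  congr 1; ext κ
  simp only [Finset.mem_filter, Finset.mem_univ, true_and, abs_mul]
  rw [show |sgn τ κ| = 1 by unfold sgn; rw [abs_pow, abs_neg, abs_one, one_pow], one_mul]

/-- `nNear` is invariant under relabelling. -/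
theorem nNear_perm (C : Fin 4 → ℝ) (π : Equiv.Perm (Fin 4)) : nNear (permC π C) = nNear C := by
  unfold nNear permC
  rw [show (Finset.univ.filter fun κ : Fin 4 => Real.cos (1 / 2) < |C (π κ)|) =
      (Finset.univ.filter fun ν : Fin 4 => Real.cos (1 / 2) < |C ν|).map π.symm.toEmbedding by
    ext μ; simp [Finset.mem_map_equiv], Finset.card_map]

/-- Sign flips do not change absolute values. -/
theorem abs_reflectC (C : Fin 4 → ℝ) (τ : Fin 4 → ZMod 2) (κ : Fin 4) : |reflectC τ C κ| = |C κ| := by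
  unfold reflectC
  rw [abs_mul, show |sgn τ κ| = 1 by unfold sgn; rw [abs_pow, abs_neg, abs_one, one_pow], one_mul]

/-- Regions are invariant under sign flips. -/
theorem InRegion.reflect {r : ℕ} {C : Fin 4 → ℝ} (τ : Fin 4 → ZMod 2) (h : InRegion r C) :
    InRegion r (reflectC τ C) := by
  obtain ⟨h1, h2⟩ := h
  refine ⟨fun κ => by rw [abs_reflectC]; exact h1 κ, ?_⟩
  rw [nNear_reflect]
  split_ifs at h2 ⊢ with hr
  · exact h2
  · exact ⟨h2.1, by obtain ⟨κ, hκ⟩ := h2.2; exact ⟨κ, by rw [abs_reflectC]; exact hκ⟩⟩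

/-- Regions are invariant under relabelling. -/
theorem InRegion.perm {r : ℕ} {C : Fin 4 → ℝ} (π : Equiv.Perm (Fin 4)) (h : InRegion r C) :
    InRegion r (permC π C) := by
  obtain ⟨h1, h2⟩ := h
  refine ⟨fun κ => h1 (π κ), ?_⟩
  rw [nNear_perm]
  split_ifs at h2 ⊢ with hr
  · exact h2
  · exact ⟨h2.1, by obtain ⟨κ, hκ⟩ := h2.2; exact ⟨π.symm κ, by show |C (π (π.symm κ))| ≤ _; rw [π.apply_symm_apply]; exact hκ⟩⟩

/-- `nNear` as a sum of indicators (for case analysis). -/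
theorem nNear_eq_sum (C : Fin 4 → ℝ) :
    (nNear C : ℕ) = (if Real.cos (1 / 2) < |C 0| then 1 else 0) + (if Real.cos (1 / 2) < |C 1| then 1 else 0)
      + (if Real.cos (1 / 2) < |C 2| then 1 else 0) + (if Real.cos (1 / 2) < |C 3| then 1 else 0) := by
  unfold nNear
  rw [Finset.card_filter, Fin.sum_univ_four]

/-- Crude rational bounds on `cos ½` from `Real.cos_bound`: `0.8717 ≤ cos ½ ≤ 0.8783`. -/
theorem cos_half_bounds : (8717 / 10000 : ℝ) ≤ Real.cos (1 / 2) ∧ Real.cos (1 / 2) ≤ 8783 / 10000 := by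
  have h := Real.cos_bound (x := 1 / 2) (by norm_num)
  rw [abs_le] at h
  norm_num at h
  constructor <;> linarith [h.1, h.2]

/-- Crude rational bound on `cos (1/20)`: `cos (1/20) ≤ 0.99875033`. -/
theorem cos_twentieth_le : Real.cos (1 / 20) ≤ 99875033 / 100000000 := by
  have h := Real.cos_bound (x := 1 / 20) (by norm_num)
  rw [abs_le] at h
  norm_num at h
  linarith [h.2]

end Regions

/-! ### Scale, thresholds and root boxes -/

section Roots

/-- Numeric facts about the thresholds. -/
theorem thresholds :
    Real.cos (1 / 2) * (SC : ℝ) ≤ (K0 : ℝ) ∧ (K0m : ℝ) ≤ Real.cos (1 / 2) * (SC : ℝ) ∧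
      Real.cos (1 / 20) * (SC : ℝ) ≤ (K2 : ℝ) := by
  obtain ⟨h1, h2⟩ := cos_half_bounds
  have h3 := cos_twentieth_le
  simp only [SC, K0, K0m, K2]
  push_cast
  refine ⟨by nlinarith, by nlinarith, by nlinarith⟩

/-- Membership in a literal box from the eight coordinate inequalities. -/
theorem IBox.mem_of_bounds {S : ℕ} {a0 b0 a1 b1 a2 b2 a3 b3 : ℤ} {C : Fin 4 → ℝ}
    (h0 : (a0 : ℝ) ≤ C 0 * S ∧ C 0 * S ≤ (b0 : ℝ)) (h1 : (a1 : ℝ) ≤ C 1 * S ∧ C 1 * S ≤ (b1 : ℝ))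
    (h2 : (a2 : ℝ) ≤ C 2 * S ∧ C 2 * S ≤ (b2 : ℝ)) (h3 : (a3 : ℝ) ≤ C 3 * S ∧ C 3 * S ≤ (b3 : ℝ)) :
    IBox.mem S [(a0, b0), (a1, b1), (a2, b2), (a3, b3)] C := by
  refine ⟨fun k => ?_⟩
  fin_cases k
  · exact h0
  · exact h1
  · exact h2
  · exact h3

/-- In the sorted nonnegative chamber the collar coordinates are the last `nNear C` ones. -/
theorem collar_tail {C : Fin 4 → ℝ} (hpos : ∀ κ, 0 ≤ C κ) (h01 : C 0 ≤ C 1) (h12 : C 1 ≤ C 2) (h23 : C 2 ≤ C 3) :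
    (Real.cos (1 / 2) < C 0 ↔ 4 ≤ nNear C) ∧ (Real.cos (1 / 2) < C 1 ↔ 3 ≤ nNear C) ∧
      (Real.cos (1 / 2) < C 2 ↔ 2 ≤ nNear C) ∧ (Real.cos (1 / 2) < C 3 ↔ 1 ≤ nNear C) := by
  have habs : ∀ κ, |C κ| = C κ := fun κ => abs_of_nonneg (hpos κ)
  have e := nNear_eq_sum C
  simp only [habs] at e
  refine ⟨⟨fun hk => ?_, fun hk => ?_⟩, ⟨fun hk => ?_, fun hk => ?_⟩, ⟨fun hk => ?_, fun hk => ?_⟩,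
    ⟨fun hk => ?_, fun hk => ?_⟩⟩ <;>
  · split_ifs at e <;> first | assumption | omega | (exfalso; linarith)

/-- **Root coverage**: every sorted nonnegative point of region `r` lies in a root box of `roots r` (`r ≤ 3`). -/
theorem mem_roots {r : ℕ} (hr : r ≤ 3) {C : Fin 4 → ℝ} (hC : InRegion r C) (hpos : ∀ κ, 0 ≤ C κ)
    (h01 : C 0 ≤ C 1) (h12 : C 1 ≤ C 2) (h23 : C 2 ≤ C 3) : ∃ B ∈ roots r, IBox.mem SC B C := by
  obtain ⟨hK0, hK0m, hK2⟩ := thresholds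
  obtain ⟨hle1, hreg⟩ := hC
  have habs : ∀ κ, |C κ| = C κ := fun κ => abs_of_nonneg (hpos κ)
  simp only [habs] at hle1 hreg
  have hS : (0 : ℝ) < SC := by simp only [SC]; norm_num
  obtain ⟨t0, t1, t2, t3⟩ := collar_tail hpos h01 h12 h23
  -- generic coordinate bounds
  have lo0 : ∀ κ, ((0 : ℤ) : ℝ) ≤ C κ * SC := fun κ => by push_cast; exact mul_nonneg (hpos κ) hS.le
  have hiS : ∀ κ, C κ * SC ≤ ((SC : ℤ) : ℝ) := fun κ => by
    push_cast; nlinarith [hle1 κ]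
  have bulk : ∀ κ, ¬ Real.cos (1 / 2) < C κ → C κ * SC ≤ (K0 : ℝ) := fun κ hκ => by
    nlinarith [not_lt.1 hκ]
  have collar : ∀ κ, Real.cos (1 / 2) < C κ → (K0m : ℝ) ≤ C κ * SC := fun κ hκ => by
    nlinarith
  by_cases h3 : r < 3
  · rw [if_pos h3] at hreg
    interval_cases r
    · exact ⟨_, List.mem_singleton.2 rfl, IBox.mem_of_bounds ⟨lo0 0, bulk 0 fun h => by have := t0.1 h; omega⟩
        ⟨lo0 1, bulk 1 fun h => by have := t1.1 h; omega⟩ ⟨lo0 2, bulk 2 fun h => by have := t2.1 h; omega⟩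
        ⟨lo0 3, bulk 3 fun h => by have := t3.1 h; omega⟩⟩
    · exact ⟨_, List.mem_singleton.2 rfl, IBox.mem_of_bounds ⟨lo0 0, bulk 0 fun h => by have := t0.1 h; omega⟩
        ⟨lo0 1, bulk 1 fun h => by have := t1.1 h; omega⟩ ⟨lo0 2, bulk 2 fun h => by have := t2.1 h; omega⟩
        ⟨collar 3 (t3.2 (by omega)), hiS 3⟩⟩
    · exact ⟨_, List.mem_singleton.2 rfl, IBox.mem_of_bounds ⟨lo0 0, bulk 0 fun h => by have := t0.1 h; omega⟩
        ⟨lo0 1, bulk 1 fun h => by have := t1.1 h; omega⟩ ⟨collar 2 (t2.2 (by omega)), hiS 2⟩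
        ⟨collar 3 (t3.2 (by omega)), hiS 3⟩⟩
  · obtain rfl : r = 3 := by omega
    rw [if_neg h3] at hreg
    obtain ⟨hn3, κ, hκ⟩ := hreg
    have hc1 : Real.cos (1 / 2) < C 1 := t1.2 hn3
    have hc2 : Real.cos (1 / 2) < C 2 := t2.2 (by omega)
    have hc3 : Real.cos (1 / 2) < C 3 := t3.2 (by omega)
    have h0κ : C 0 ≤ C κ := by
      fin_cases κ
      · exact le_rfl
      · exact h01
      · exact h01.trans h12
      · exact (h01.trans h12).trans h23
    have hC0K2 : C 0 * SC ≤ (K2 : ℝ) := by nlinarith [h0κ.trans hκ]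
    by_cases hc0 : Real.cos (1 / 2) < C 0
    · exact ⟨_, List.mem_cons_of_mem _ (List.mem_singleton.2 rfl),
        IBox.mem_of_bounds ⟨collar 0 hc0, hC0K2⟩ ⟨collar 1 hc1, hiS 1⟩ ⟨collar 2 hc2, hiS 2⟩ ⟨collar 3 hc3, hiS 3⟩⟩
    · exact ⟨_, List.mem_cons_self, IBox.mem_of_bounds ⟨lo0 0, bulk 0 hc0⟩ ⟨collar 1 hc1, hiS 1⟩
        ⟨collar 2 hc2, hiS 2⟩ ⟨collar 3 hc3, hiS 3⟩⟩

end Roots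


/-- **Registered helper `stub_checkerMemRoots`** (= `mem_roots`). -/
theorem stub_checkerMemRoots : ∀ (r : ℕ), r ≤ 3 → ∀ (C : Fin 4 → ℝ), InRegion r C → (∀ κ, 0 ≤ C κ) → C 0 ≤ C 1 → C 1 ≤ C 2 → C 2 ≤ C 3 → ∃ B ∈ roots r, IBox.mem SC B C :=
  fun _ hr _ hC hpos h01 h12 h23 => mem_roots hr hC hpos h01 h12 h23

end Summit.QuantumFields.QCD.Cruxes.CriticalLineDiamagnetism.ChessboardCellGain.Checker
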